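import Summits.HubbardSuperconductivity.HubbardSuperconductivity.Theorems.KLProgrammeKLRegimeFlowReadScaleZeroSunsetCertDefsV2

/-!
# Route `KLProgramme`, crux K3 — engine-flow child (stmt-HubbardSuperconductivity-20437), stub (C) at `n = 0`, located item #22a «(C)-SCALE0-PT2»:
# THE FAR-SUP CERTIFICATE FORMAT — `SunsetFarSupRecord` / `ScaleZeroFarSupCert` (one z-UNIFORM profile for all far sites + its periodised sup)

Seat hubbard-kl-k3c5-p1 (g15; owner of #22a and of the certificate predicates).  Companion of `…SunsetCertDefsV2` (near record V2/V3: per-site profiles on the disk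
`0 < ‖z‖∞ ≤ Rc`) and `…SunsetFarGapCertDefs` (far Parseval gaps).  WHY (CERT-ARCH-g15 §4 as corrected by the zone-I pilot, KL STATUS 2026-08-28 ≈19:00Z): in the far-row
interface of record (`…SunsetFarRowsSup.farRows_le_of_l2Far_sup`, closer `…SunsetTailKlEng.sunsetRows_of_certV3_klEng`) the middle propagator at a FAR separation is booked by
`S_far = 50e^{−κ₁(Rc+1)} + ω₁(√G₀ + 10⁻¹⁰)` — a frequency-by-frequency sup derived from the k = 0 gap, which loses the cancellation between Matsubara frequencies (at Rc = 1024: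
S_far ≈ 0.04 while the true far sup of the imaginary-time kernel is ≈ 10⁻⁵).  The Bessel-kernel representation of the β = ∞ kernel,
`C_∞(z,u;μ) = (−i)^{z₀+z₁}(1/2π)∫e^{−itμ}J_{z₀}(2t)J_{z₁}(2t)ĥ(t,u)dt`, `|ĥ(t,u)| = |κ(√(t²+u²))|`, gives a μ-FREE, z-MONOTONE-FRIENDLY majorant
`P^maj_z(u) = (1/π)∫|J_{z₀}J_{z₁}(2t)||κ(√(t²+u²))|dt` whose sup over `‖z‖∞ > Rc` is ONE profile `Pfar(u)` (certified 1-D object) — small (≈ 10⁻⁵ at Rc = 1024) because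
`J_n(2t)` is dark for `2t < n`.  This file is the FORMAT of that certificate; the reader/closer twin (S_far ↦ the periodised sup of `Pfar` + tails, through p1 g20's door
`enorm_gridCov_offSite_le_tsum_profile` at far sites) is p1's lane.

* `SunsetFarSupRecord` — the record: the certified periodised far sup `Sfar` (rational; written by `gen_record.py`);
* `ScaleZeroFarSupCert c r` — what the kit certifies for the μ-cell and split radius of the near record `c`: there is a measurable profile `P : ℝ → ℝ≥0∞` with
  (i′) FATTENED PROFILE DOMINATION of the β = ∞ off-site kernel at EVERY far site, uniformly on the μ-cell — literally clause (i) of `ScaleZeroSunsetCertV3` with `z ∈ c.disk` replaced by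
  `z ∉ insert 0 c.disk` and `P z` by the single `P`; (ii′) PERIODISED SUP on the base octave: for `β ∈ [klBetaMin, 2·klBetaMin]` and `τ ∈ [0, β]`, `Σ_m P(τ + mβ) ≤ Sfar`
  (every `β ≥ klBetaMin` follows in the reader by sub-sums, as in `…ScaleZeroBetaWindow.sunsetShape_le_of_window`).
Certified numerically (interval arithmetic, two implementations), discharged by the compute certificate (D-0022 lane), NEVER inside Lean.  Definitions only; nothing here asserts (C),
any stub of 20437, K3 or superconductivity; no certificate is claimed.  References: BGM 2006 §2.3–§2.4 [cite: BenfattoGiulianiMastropietro2006].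
-/

noncomputable section

namespace Summit.HubbardSuperconductivity.HubbardSuperconductivity.Theorems.KLRegimeSplit

set_option linter.dupNamespace false -- summit = problem name (single-conjunct summit), D-0017

open Literature.MathematicalPhysics.QuantumLattice Literature.Probability.LatticeModels Literature.Analysis.FunctionSpaces
open Summit.HubbardSuperconductivity.HubbardSuperconductivity.Theorems.DispersionFlow
open MeasureTheory Set Finset Complex UnitAddTorus Real
open scoped FourierTransform Nat ENNReal NNReal

/-- **The far-sup record** of one μ-cell / split radius (KIT JOB B″): the certified periodised sup `Sfar` of the z-uniform far profile (rational, written by `gen_record.py`). -/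
structure SunsetFarSupRecord where
  /-- certified bound of `Σ_m Pfar(τ + mβ)` over `τ ∈ [0, β]`, `β ∈ [klBetaMin, 2·klBetaMin]` -/
  Sfar : ℚ

/-- **`ScaleZeroFarSupCert c r`** — what the kit certifies about the FAR sites of the near record `c` (those `z ∉ {0} ∪ c.disk`, i.e. `‖z‖∞ > c.Rc`): a single measurable
profile `P` dominating the fattened β = ∞ off-site kernel `(1/2π)·𝓕(G_{μ,z})(u/2π)` at every far site uniformly on the μ-cell (clause (i) of `ScaleZeroSunsetCertV3`, z-uniform),
whose periodisation over the base octave is `≤ Sfar`.  A named hypothesis of the far-row reader, never proved in Lean. -/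
def ScaleZeroFarSupCert (c : SunsetCellRecordV2) (r : SunsetFarSupRecord) : Prop :=
  ∃ P : ℝ → ℝ≥0∞, Measurable P ∧
    -- (i′) fattened profile domination at every far site, uniformly on the μ-cell
    (∀ μ : ℝ, (c.μlo : ℝ) ≤ μ → μ ≤ c.μhi → ∀ z : Fin 2 → ℤ, z ∉ insert (0 : Fin 2 → ℤ) c.disk → ∀ t u : ℝ, |u - t| ≤ (2 : ℝ)⁻¹ ^ 10 →
      (‖((1 / (2 * π) : ℝ) : ℂ) * 𝓕 (fun om : ℝ => mFourierCoeff (Torus.descend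
          (fun y : Momentum => uvSymbolFn 1 klE0 (frameLevel μ 0 ((2 * π) • y)) om) (uvSpatialSymbol_isLatticePeriodic 1 klE0 μ 0 om))
          (-z)) (u / (2 * π))‖₊ : ℝ≥0∞) ≤ P t) ∧
    -- (ii′) periodised sup on the base octave
    (∀ β : ℝ, klBetaMin ≤ β → β ≤ 2 * klBetaMin → ∀ τ : ℝ, 0 ≤ τ → τ ≤ β →
      (∑' m : ℤ, P (τ + m * β)) ≤ ENNReal.ofReal (r.Sfar : ℝ))

end Summit.HubbardSuperconductivity.HubbardSuperconductivity.Theorems.KLRegimeSplit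

end
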